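import Mathlib
import HarnessLib
import HarnessLib.Audit
import Summits.ValiantsHypothesis.Statement

/-!
Route: PolarDegree

CLOSED (retired) 2026-08-15T13:51:34Z by operator:999:1257524 — reason: not-a-thesis: assembly does not conclude the sub-problem Statement — note: D-0027 §2.1 audit (human 2026-08-15: routes that do not decide the summit are removed): the assembly concludes `PermanentSuperlinear`, not the sub-problem statement; a NEW conforming route may be opened from the same idea (generated `closes : … → _root_.ValiantsHypothesis`).. The file is kept as the record of this route; refuted decls are indexed as negative knowledge (`ledger negatives`).

# Route PolarDegree — Strassen–Baur–Strassen on the sub-permanent map — the polar degree of per_n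
decides Ω(n² log n)

Realises idea card ValiantsHypothesis/ValiantsHypothesis/polar-degree-baur-strassen. HONEST SCOPE:
this is a
WAYPOINT route, not a route to the summit. Its TARGET is PermanentSuperlinear — the first
superlinear circuit lower
bound for the permanent itself, ∃ c > 0 with c·n²·log n ≤ L_ℂ(per_n) for all large n (named open by
Burgisser2024,
p. 4: "nobody knows how to prove a lower bound of order n² log n for the evaluation of the n×n
determinant or n×n
permanent"). The summit VP_ℂ ≠ VNP_ℂ implies that L(per_n) is not O(n²) (support
SummitForcesWaypoint, from the proved
VNP-completeness of per), so the target lives in the region the summit forces; the degree method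
provably caps at
N·log(deg) = O(n² log n) and can never reach the summit — that ceiling is stated, not evaded.
It suffices to show X = SubPermanentCountAux: for some c > 0 and all large n there are n²
affine-linear equations in
(x, ∇per_n(x), g(x)) — x ∈ ℂ^{n×n}, ∇per_n(x) = the n² maximal sub-permanents of x, g = any
auxiliary tuple computed
by a fan-in-two circuit with O(n²) gates — whose solution set is FINITE of cardinality ≥
(c·n)^{c·n²}. The pure case
g = ∅ (crux SubPermanentCount) says exactly: the affine graph Γ(∇per_n) ⊂ ℂ^{n²} × ℂ^{n²} has degree
≥ (cn)^{cn²}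
(BurgisserClausenShokrollahi1997, Thm (8.30) and (8.39)(A): the degree of a graph is the maximal
finite number of
solutions of an affine-linear section). Assembly: Baur–Strassen (a circuit of size ≤ κ·L(per_n)
exposing all ∂per_n/∂x_ij)
+ Strassen's degree bound in counting form (a fan-in-two circuit with s gates is a complete
intersection of ≤ s
equations of degree ≤ 2 in n²+s unknowns, so by the tree's PROVED zero-dimensional Bézout
`Literature.RingTheory.ZeroDimensional.ncard_zeroSet_le_pow` every finite affine section of the
graph of its gate
values has ≤ 2^{s+n²} points) give (cn)^{cn²} ≤ 2^{κ·L(per_n) + O(n²)}, i.e. L(per_n) ≥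
(c/κ)·n²·log₂ n − O(n²).
Lean: `Summit.ValiantsHypothesis.ValiantsHypothesis.Theses.PolarDegree.SubPermanentCountAux` (decl
of this route; one-line Prop in the crux block below, elaborated in Sketch.lean rc 0)

## Assembly
BaurStrassenGradient gives κ and, for f = per_n, a fan-in-two circuit P with ≤ κ·L(per_n) gates and
operands u_ij
evaluating to ∂per_n/∂x_ij; SubPermanentCountAux gives c, C and for large n a circuit Q (≤ C·n²
gates), operands w and
a finite section S of size ≥ (cn)^{cn²}; form R := P.append Q (fan-in two, size = P.size + Q.size;
P's operands
truncated at P.size, Q's shifted by P.size — `ArithCircuit.append`, `gateValues_append`), read (u,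
w) off R and apply
CircuitSectionCount with τ = (Fin n × Fin n) ⊕ Fin m and B'' = [B | B']: (cn)^{cn²} ≤ #S ≤ 2^{κ·L +
C·n² + n²}, so
c·n²·log₂(cn) ≤ κ·L(per_n) + (C+1)·n² and L(per_n) ≥ (c/2κ)·n²·log₂ n for n large (κ = 0 is
contradictory for large
n). Real-analysis bookkeeping (Real.log vs rpow) plus the circuit-append lemmas; no mathematics
beyond the three
antecedents. The target is a WAYPOINT: Assembly ends in PermanentSuperlinear, not in the summit (see
Thesis /
SummitForcesWaypoint).

Rationale: WHY THIS LINE. Strassen's degree bound (Strassen1973DegreeBound; BurgisserClausenShokrollahi1997 Thm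
(8.36)) with the Baur–Strassen
derivative inequality (BaurStrassen1983; BCS Thm (7.7), Rem (7.8)(1)) is the only engine that has
ever produced
superlinear lower bounds in the unrestricted algebraic model (Burgisser2024 p. 4), and BCS Thm
(8.46) shows the exact
template on a MULTILINEAR polynomial: L(σ_q) ≥ ⅓(n−q+1)log(q−1) by counting the solutions of one
cleverly mixed system
in (x, ∇σ_q(x), σ_1..σ_{q−1}); chapter 8 of BCS applies it to power sums, symmetric functions,
interpolation and the
Chinese remainder map and never to det or per (held text pp. 200–243 grepped). The route imports
ENUMERATIVE /
INTERSECTION-THEORETIC geometry of one explicit square system — "all maximal sub-permanents take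
prescribed affine
values" — whose count is the (affine) polar degree of the permanental hypersurface: its projective
shadows are the
projective degrees of the polar map of {z^n + n·per_n = 0}, computable as sectional Euler
characteristics of
hypersurface complements (DimcaPapadima2003 Thm 1; Huh2012 Thm; Aluffi2013), its base locus is
Sing{per_n = 0} =
{permanental rank ≤ n−2} of codimension ≥ 6 (BoraleviEtAl2025, Thm 'codim of sing loc'; det:
codimension 4), and its
Bernstein–Kushnirenko ceiling is (n−1)^{n²}·2^{−O(n)} (slab estimate in Numbers). The determinant is
a PROVABLE foil,
repairing the gap flagged by the card's novelty audit: because X·adj X = det X·I is n² quadrics, the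
graph of
∇det_n = cofactor map is a hypersurface section (λ = det X, degree n) of a component of a complete
intersection of n²
quadrics, so deg Γ(∇det_n) ≤ n·2^{n²} and EVERY finite affine section count is 2^{O(n²)} (support
AdjugateSectionBound; Heintz1983 Thm 1 / BCS (8.28); the polar map of det is the Cremona involution
X ↦ X⁻¹,
Dolgachev2000) — the method gives det nothing beyond O(n²), and any superlinear outcome for per is
carried entirely
by the absence of a permanental Cramer rule. No prior route or negative of this summit touches
circuit size L(per_n)
directly (DetQP/GCTMult/IntegralGCT: dc and orbit closures; Depth4: bounded depth;
TauConst/BoolTransfer: transfer;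
Elusive: Raz maps); the negatives index is empty at filing (0 refuted statements;
Theorems/ElusiveRefutations.lean concerns Raz-map candidates, unrelated).

RANKED CRUXES. #0 PermanentSuperlinear (target) — The waypoint: there is c > 0 such that for all
large n the fan-in-two circuit complexity of the n×n permanent over ℂ is at least c·n²·log n. (why
it might fail: Only if the degree of Γ(∇per_n) is 2^{O(n²)} infinitely often (crux
SubPermanentDegenerate-type structure); no other method is on offer for Ω(n² log n) — open since
1983 (Burgisser2024 p.4).) [Burgisser2024, BaurStrassen1983, BurgisserClausenShokrollahi1997]
#2 BaurStrassenGradient (crux) — Baur–Strassen in the tree's circuit model (card item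
'BaurStrassenDerivative'): there is a universal κ such that for every polynomial f over ℂ in
finitely many variables some fan-in-two circuit with at most κ·complexity(f) gates has every partial
derivative ∂f/∂x_i among its operand values (gate values, variables or constants). Theorem in print
(reverse-mode differentiation; κ = 3 nonscalar, 4–5 total), unproved in Lean, hence FIRST crux per
the plancard rule; gating for the target only, not for the bet. [difficulty: M] (why it might fail:
Only via a model mismatch: weighted fan-in-two sum gates c•u+d•v count 1, junk gate references
evaluate to 0, complexity := sInf; the mathematics (reverse mode, ≤ 5 gates per original gate) is
BCS Thm (7.7)/(7.8)(1).) [BaurStrassen1983, BurgisserClausenShokrollahi1997, Burgisser2000]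
#3 SubPermanentCount (crux) — THE BET, pure form (card Thesis P, in the counting form of BCS
(8.30)/(8.39)(A)): there is c > 0 such that for all large n some n² affine-linear equations in (x,
∇per_n(x)) — A·x + B·(per of the (n−1)-minor complementary to (i,j))_{ij} = v — have a FINITE
solution set in ℂ^{n×n} of cardinality ≥ (c·n)^{c·n²}; equivalently deg Γ(∇per_n) ≥ (cn)^{cn²}
(Bezout ceiling (n−1)^{n²}, BKK ceiling (n−1)^{n²}2^{−O(n)}). [difficulty: XL] (why it might fail: A
hidden permanental identity could make the sub-permanent system Bernstein-degenerate with all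
section counts 2^{O(n²)}, exactly as X·adjX = detX·I does for det (AdjugateSectionBound); the excess
lives in deep degrees (base locus {prk ≤ n−2}, codim ≤ 2n).) [BurgisserClausenShokrollahi1997,
BoraleviEtAl2025, Huh2012, Aluffi2013, DimcaPapadima2003, MignonRessayre2004,
LaubenbacherSwanson2000]
#4 SubPermanentDegenerate (crux) — Dichotomy partner (negative side, staffed deliberately): a
uniform 2^{O(n²)} bound — there is C with #S ≤ 2^{C·n²+C} for every n and every finite affine
section S of Γ(∇per_n). If proved the route is dead (kill criterion) AND a new structural fact about
permanental minors is on record (a 'Cramer rule for per at the level of degrees', feeding card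
anti-cramer-direct-sum negatively); at most one of SubPermanentCount / SubPermanentDegenerate holds.
[difficulty: L] (why it might fail: per has no adjugate identity (X·padj(X)ᵀ = per·I + repeated-row
permanents ≠ 0), its polar base locus has codim ≥ 6 > 4 = det's, and the Bernstein count of the
support is (n−1)^{n²}2^{−O(n)}: generic-like counts are the default.) [BoraleviEtAl2025,
BurgisserClausenShokrollahi1997, Vonzurgathen1987, Dolgachev2000]
#5 SubPermanentCountAux (crux) — The bet in its weakest sufficient form (assembly antecedent; BCS
(8.46) template): as SubPermanentCount, but the n² affine equations may also involve auxiliary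
polynomials g_1..g_m read off a fan-in-two circuit Q with ≤ C·n² gates (e.g. per_n itself,
row/column sums, leading-block permanents used to triangularise the count). Implied by
SubPermanentCount (PureImpliesAux); equivalent to it up to the constant c by the degree bound
applied to Q, but provable by an explicit triangular count without Heintz's attainment theorem.
[deps: SubPermanentCount] [difficulty: XL] (why it might fail: Same as SubPermanentCount (auxiliary
O(n²)-gate functions change log₂ of the count by O(n²) only, BCS (8.34)(2)); fails iff deg Γ(∇per_n)
= 2^{O(n²)} infinitely often.) [BurgisserClausenShokrollahi1997, BaurStrassen1983, BoraleviEtAl2025]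
#9 CircuitSectionCount (support) — Strassen's degree bound in counting form, from the tree: for a
fan-in-two circuit P over variables σ and any operands u : τ → Operand read off its gate values,
every FINITE set {x : A·x + B·(u(x)) = v} (|σ| affine equations) has at most 2^{P.size + |σ|}
points. Proof: (x, z) ↦ gate equations z_g = (sum gate: linear | product gate: quadratic) plus the
|σ| linear equations is a system of degree ≤ 2 in |σ|+P.size unknowns whose zero set is in bijection
with the section (z is determined by x; junk references read 0 consistently), then
`Literature.RingTheory.ZeroDimensional.ncard_zeroSet_le_pow` with D = 2 (PROVED; BCS Rem (8.37)).
[difficulty: provable-now] [BurgisserClausenShokrollahi1997, Heintz1983, Strassen1973DegreeBound]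
#9 PureImpliesAux (support) — Glue: the pure count implies the auxiliary form (take m = 0, Q the
empty circuit ⟨[], const 0⟩, C = 0). [difficulty: provable-now] [BurgisserClausenShokrollahi1997]
#9 AdjugateSectionBound (support) — The determinant foil (calibration; repairs the audit's 'd_N =
n−1 is not enough'): EVERY finite affine section of the graph of ∇det_n (the cofactor map) has at
most (n+1)·4^{n²} points — any 2^{O(n²)} bound is the point, the proof gives n·2^{n²}: W = {XY = λI}
⊂ ℂ^{2n²+1} is n² quadrics (deg ≤ 2^{n²}, Heintz/BCS (8.28)); its main component W₀ = closure{(X,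
λX⁻¹, λ)} is irreducible of dim n²+1; Γ' = {(X, adj X, det X)} is a component of W₀ ∩ {λ = det X}
(deg ≤ n·2^{n²}); project λ away (BCS (8.32)) and cut by the affine section (BCS (8.28)).
Equivalently the projective degrees of matrix inversion are ≤ binomial(n²−1, a) (refined Bezout on
the Segre variety, XY ∈ ℂ·I being n²−1 hyperplane sections). So Strassen–Baur–Strassen yields ≤
O(n²) for det: Cramer's rule (BCS Cor (7.9)) is exactly the degeneracy. [difficulty: M]
[BurgisserClausenShokrollahi1997, Heintz1983, Dolgachev2000]
#9 SummitForcesWaypoint (support) — Honest-scope bookkeeping: the summit forces the waypoint region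
— VP_ℂ ≠ VNP_ℂ implies L(per_n) is not O(n²) (per is VNP-complete:
`Literature.Computability.AlgebraicComplexity.isVNPComplete_perPoly_holds`,
`VP_ne_VNP_iff_not_isPComputable_of_isVNPComplete`, `isPFamily_perPoly`); the target
PermanentSuperlinear implies the same trivially. Neither converse is claimed. [difficulty:
provable-now] [Valiant1979, Burgisser2000, BurgisserClausenShokrollahi1997]

TWO-LAYER PLAN. Foreseen glued splits once a crux moves (nothing filed now). SubPermanentCount ⇐
(BKK exactness) → (volume): C₁ =
'per_n's coefficient vector is Bernstein-nondegenerate up to 2^{O(n²)}: the generic section count is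
≥ 2^{−O(n²)}·n²!·vol Q_n'
and C₂ = 'n²!·vol(Q_n) ≥ (cn)^{cn²}' for Q_n = conv(0, e_ij, {M − e_ij : M a permutation matrix
through (i,j)}) (C₂ is
convex geometry, nearly certain: Q_n ⊇ the slab {X ≥ 0, row/col sums ≤ 1, ΣX = n−1} pyramid).
SubPermanentCountAux ⇐
(triangular system à la BCS (8.46)): C₁' = an explicit mixed system (prescribe leading-block
sub-permanents / row data)
whose solution count factorises, C₂' = each factor ≥ (cn)^{cn}. Topological handle for either:
projective degrees of
the polar map of {z^n + n·per_n(x) = 0} ⊂ P^{n²} = (−1)-signed sectional Euler characteristics of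
the complement
(DimcaPapadima2003, Huh2012, Aluffi2013) — a glue 'max_k μ^k ≥ (cn)^{cn²} → SubPermanentCount' would
need Heintz (8.30)
in Lean and is deliberately not filed.

KILL CRITERIA. SubPermanentDegenerate PROVED (any uniform 2^{O(n²)} bound on finite section counts
of Γ(∇per_n)) closes the route
`refuted:SubPermanentCount` — the degree method then provably cannot beat O(n²) for per, exactly as
for det; record the
identity found as negative knowledge for anti-cramer-direct-sum. A refutation of
SubPermanentCountAux alone (with
SubPermanentCount open) forces a restate with larger auxiliary budget, not a close. A proof
elsewhere of
L(per_n) = O(n²)·anything-superlinear by another method moots the target but not the cruxes.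
BaurStrassenGradient
refuted = model bug in ArithCircuit/complexity: pivot to restating κ·(complexity f + |σ|), never a
close.

NOT DECOMPOSED YET. Deliberately not split at open: (i) which degree k of the polar map carries the
mass (pure fibre count d_N vs mixed
sections) — the crux allows any affine section; (ii) the choice of auxiliary functions in
SubPermanentCountAux; (iii)
the BKK-exactness / mixed-volume split above; (iv) constants κ (3–5) and c; (v) the
real-structured-point and
toric-degeneration strategies of the card (real root counts at y₀ structured; polyhedral homotopy
path survival) —
all layer-2 after the n = 3, 4 computation says where the count sits.

CHEAPEST FALSIFIER. n = 3 and n = 4 by certified computation (kit; msolve over 𝔽_p/ℚ or certified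
homotopy continuation): for random
rational (A, B, v) count the solutions of the 9 equations of degree ≤ 2 (per_3, det_3; Bezout 512
both) and of the 16
cubics (per_4 vs det_4; Bezout 3^16 ≈ 4.3·10⁷, polyhedral homotopy with the mixed volume of Q_4 as
path number); the
det controls must respect AdjugateSectionBound (and in truth be far smaller), and a per_4 count of
the same order as
det_4's is the first evidence for SubPermanentDegenerate, a count ≫ det_4's (towards 3^16) the first
evidence for
SubPermanentCount. Not run in this planning session (no kit budget used); filed as an informal
support item for refuters.
Structural falsifier already checked by hand: the Bernstein–Kushnirenko ceiling n²!·vol(Q_n) is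
(n−1)^{n²}·2^{−O(n)}
(Dirichlet slab estimate), so the toric bound does NOT already kill the bet.

NUMBERS. Bezout ceiling for any section count: (n−1)^{n²} (9 quadrics: 512 at n = 3; 3^16 = 43 046
721 at n = 4). Det foil:
deg Γ(∇det_n) ≤ n·2^{n²} (1 536 at n = 3 — above Bezout, so no separation is visible at n = 3 from
the foil alone;
262 144·(5/4) vs 4.3·10⁷ at n = 4). Pure polar fibre of det: d_N(adj_n) = n − 1; projective degrees
of inversion ≤
binomial(n²−1, a); n = 3 inversion multidegrees (1,2,4,8,10,8,4,2,1). Base loci: {rk ≤ n−2} codim 4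
(det) vs {prk ≤ n−2}
codim ∈ [6, 2n] for n ≥ 6 (BoraleviEtAl2025). Baur–Strassen constants: 3 (nonscalar), 4 (total, BCS
Rem (7.8)(1)), ≤ 5
in the tree's gate model. Needed growth: log₂ #S = ω(n²) for anything superlinear; (cn)^{cn²} for
Ω(n² log n).

DEFINITION REQUESTS. None: every statement is typed over existing declarations (ArithCircuit,
complexity, perPoly, detPoly, pderiv,
Set.ncard). Facts wanted as Literature theorems (not hypotheses): Baur–Strassen (crux 2) and the
counting degree bound
(support CircuitSectionCount) — both filed as items of this route so the import cone carries no
unproved fact.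

Novelty: Searches (2026-08-15): `lit search --hybrid "degree bound graph of rational map Bezout inequality
derivative inequality"` (12 docs; BCS97 pp. 200–243 read:
(7.7),(7.9),(8.28),(8.30),(8.36)–(8.40),(8.46); grep permanent|determinant|adjug|Cramer over ch.
7–8: only Cor (7.9)); `lit read arxiv:2406.06217 --grep` (Burgisser2024 p.4 quote confirmed); zbMATH
"homaloidal polynomial" (15: Dolgachev2000, Bruno 2007, FassarellaMedeiros 2012
doi:10.1112/jlms/jds005, Huh 2013, CoxMisraSemnani 2024 doi:10.2140/astat.2024.15.167 — all
det-like/homaloidal, none on per), zbMATH "permanental hypersurface" (1: BoraleviEtAl2025 =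
arXiv:2402.17839, read), zbMATH "permanental ideals" (16: LaubenbacherSwanson2000, Kirkup 2008, Chau
2025–26), zbMATH "polar map determinant multidegree Cremona" (0), `lit galaxy search "degree of the
gradient map" --star all` (5, irrelevant; galaxy saturated for further queries), `lit vsearch`
matrix-inversion multidegrees (0 relevant), `lit frontier ValiantsHypothesis --since 2020` (30; none
on general-circuit lower bounds for per beyond dc/degree-2), `lit bridges --cross any`;
OpenAlex/S2/arXiv APIs returned HTTP 429 at search time.
Nearest prior art found: BaurStrassen1983 + Strassen1973DegreeBound as presented in
BurgisserClausenShokrollahi1997 Thm (8.46) (the mixed-system count for the multilinear σ_q — the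
template), Burgisser2024 p.4 (names the target as open for det and per), Dolgachev2000 /
doi:10.2140/astat.2024.15.167 (polar geometry of det: homaloidal, inve  [refs: 10.1112/jlms/jds005, 10.2140/astat.2024.15.167, 2406.06217, 2402.17839, arxiv:2406.06217, doi:10.1112/jlms/jds005, doi:10.2140/astat.2024.15.167, Burgisser2024, Dolgachev2000, BoraleviEtAl2025, LaubenbacherSwanson2000, BaurStrassen1983, BurgisserClausenShokrollahi1997, Huh2012, Aluffi2013, DimcaPapadima2003]

Barriers (technique_class: degree-bound, baur-strassen, polar-degree, bezout-counting): - technique_class: degree-bound, baur-strassen, polar-degree, bezout-counting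
- Literature.Barriers.ValiantsHypothesis.PermanentCharTwo: evaded by construction and consistently —
in characteristic 2 the sub-permanent system IS the adjugate system, so every section count is ≤
n·2^{n²} there and SubPermanentCount is false; the crux is stated over ℂ and any proof must use char
≠ 2 (e.g. positivity/real structure or the codim ≥ 6 base locus, which is char-2-false).
- Literature.Barriers.ValiantsHypothesis.NoncommutativeExtensions: not met — the target Ω(n² log n)
is below the 6dn+1 = 6n³+1 ceiling of extension-robust arguments, and Bezout counting is commutative
(not extension-robust) anyway.
- Literature.Barriers.ValiantsHypothesis.AlgebraicNaturalProofs: it does not apply and the route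
does not pretend to reach VP: the graph degree is maximal on easy polynomials (Σ x_i^d ∈ VP), so the
measure is not a distinguisher against VP — which is exactly the intrinsic ceiling N·log(deg) stated
in the Thesis; the bet is only the waypoint.
- Literature.Barriers.ValiantsHypothesis.PartialDerivativesDetPerm: evaded — that barrier kills
measures that are functions of the flattening-rank profile (equal for det and per); section counts
of Γ(∇f) separate det (≤ n·2^{n²}, AdjugateSectionBound) from the conjectured per behaviour and are
not rank functions.
- Literature.Barriers.ValiantsHypothesis.RankMethods: not in class — degree of a graph is
multiplicative/enumerative, not a sub-additive rank o

History (route lifecycle, newest last):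
- 2026-08-15T13:51:34Z · CLOSED retired — not-a-thesis: assembly does not conclude the sub-problem Statement (operator:999:1257524)

sub-problem: ValiantsHypothesis · status: closed(retired) · opened planner-plancard-ValiantsHypothesis-ValiantsH-6d2827c9-0 2026-08-15T11:45:18Z · rev 0 · ledger route-ValiantsHypothesis-PolarDegree
GENERATED by the gate from the ledger (D-0016/17). Provers cite these decls: `theorem foo : Summit.ValiantsHypothesis.ValiantsHypothesis.Theses.PolarDegree.<Decl> := …` in Summits/ValiantsHypothesis/ValiantsHypothesis/Theorems/<Name>.lean.
-/

namespace Summit.ValiantsHypothesis.ValiantsHypothesis.Theses.PolarDegree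

open scoped BigOperators Topology Manifold Classical MeasureTheory ProbabilityTheory Matrix InnerProductSpace ComplexConjugate ContinuousMap
open Filter Set Function TopologicalSpace MeasureTheory

attribute [summit_statement] _root_.ValiantsHypothesis

open Literature.PNP

/-- item stmt-ValiantsHypothesis-6241 · target · rank 0 · closed · moot by None · by planner
why it might fail: Only if the degree of Γ(∇per_n) is 2^{O(n²)} infinitely often (crux SubPermanentDegenerate-type structure); no other method is on offer for Ω(n² log n) — open since 1983 (Burgisser2024 p.4).
sources: Burgisser2024, BaurStrassen1983, BurgisserClausenShokrollahi1997
[target] The waypoint: there is c > 0 such that for all large n the fan-in-two circuit complexity of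
the n×n permanent over ℂ is at least c·n²·log n. -/
@[route_item "route-ValiantsHypothesis-PolarDegree"]
def PermanentSuperlinear : Prop :=
  ∃ c : ℝ, 0 < c ∧ ∃ n₀ : ℕ, ∀ n ≥ n₀, c * (n : ℝ) ^ 2 * Real.log (n : ℝ) ≤ (Literature.Computability.AlgebraicComplexity.complexity (Literature.Computability.AlgebraicComplexity.perPoly (Fin n) ℂ) : ℝ)

/-- item stmt-ValiantsHypothesis-6242 · crux · rank 2 · closed · moot by None · by planner
why it might fail: Only via a model mismatch: weighted fan-in-two sum gates c•u+d•v count 1, junk gate references evaluate to 0, complexity := sInf; the mathematics (reverse mode, ≤ 5 gates per original gate) is BCS Thm (7.7)/(7.8)(1).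
sources: BaurStrassen1983, BurgisserClausenShokrollahi1997, Burgisser2000
[crux] Baur–Strassen in the tree's circuit model (card item 'BaurStrassenDerivative'): there is a
universal κ such that for every polynomial f over ℂ in finitely many variables some fan-in-two
circuit with at most κ·complexity(f) gates has every partial derivative ∂f/∂x_i among its operand
values (gate values, variables or constants). Theorem in print (reverse-mode differentiation; κ = 3
nonscalar, 4–5 total), unproved in Lean, hence FIRST crux per the plancard rule; gating for the
target only, not for the bet. [difficulty: M] -/
@[route_item "route-ValiantsHypothesis-PolarDegree"]
def BaurStrassenGradient : Prop :=
  ∃ κ : ℕ, ∀ (σ : Type) [Fintype σ] [DecidableEq σ] (f : MvPolynomial σ ℂ), ∃ P : Literature.Computability.AlgebraicComplexity.ArithCircuit ℂ σ, P.IsFanInTwo ∧ P.size ≤ κ * Literature.Computability.AlgebraicComplexity.complexity f ∧ ∀ i : σ, ∃ u : Literature.Computability.AlgebraicComplexity.ArithCircuit.Operand ℂ σ, u.eval (Literature.Computability.AlgebraicComplexity.ArithCircuit.gateValues P.gates) = MvPolynomial.pderiv i f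

/-- item stmt-ValiantsHypothesis-6243 · crux · rank 3 · closed · moot by None · by planner
why it might fail: A hidden permanental identity could make the sub-permanent system Bernstein-degenerate with all section counts 2^{O(n²)}, exactly as X·adjX = detX·I does for det (AdjugateSectionBound); the excess lives in deep degrees (base locus {prk ≤ n−2}, codim ≤ 2n).
sources: BurgisserClausenShokrollahi1997, BoraleviEtAl2025, Huh2012, Aluffi2013, DimcaPapadima2003, MignonRessayre2004
[crux] THE BET, pure form (card Thesis P, in the counting form of BCS (8.30)/(8.39)(A)): there is c
> 0 such that for all large n some n² affine-linear equations in (x, ∇per_n(x)) — A·x + B·(per of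
the (n−1)-minor complementary to (i,j))_{ij} = v — have a FINITE solution set in ℂ^{n×n} of
cardinality ≥ (c·n)^{c·n²}; equivalently deg Γ(∇per_n) ≥ (cn)^{cn²} (Bezout ceiling (n−1)^{n²}, BKK
ceiling (n−1)^{n²}2^{−O(n)}). [difficulty: XL] -/
@[route_item "route-ValiantsHypothesis-PolarDegree"]
def SubPermanentCount : Prop :=
  ∃ c : ℝ, 0 < c ∧ ∃ n₀ : ℕ, ∀ n ≥ n₀, ∃ (A B : Matrix (Fin n × Fin n) (Fin n × Fin n) ℂ) (v : Fin n × Fin n → ℂ), {x : Fin n × Fin n → ℂ | ∀ k, ∑ p, A k p * x p + ∑ p, B k p * MvPolynomial.eval x (MvPolynomial.pderiv p (Literature.Computability.AlgebraicComplexity.perPoly (Fin n) ℂ)) = v k}.Finite ∧ (c * n) ^ (c * (n : ℝ) ^ 2) ≤ (({x : Fin n × Fin n → ℂ | ∀ k, ∑ p, A k p * x p + ∑ p, B k p * MvPolynomial.eval x (MvPolynomial.pderiv p (Literature.Computability.AlgebraicComplexity.perPoly (Fin n) ℂ)) = v k}.ncard : ℕ) : ℝ)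

/-- item stmt-ValiantsHypothesis-6244 · crux · rank 4 · closed · moot by None · by planner
why it might fail: per has no adjugate identity (X·padj(X)ᵀ = per·I + repeated-row permanents ≠ 0), its polar base locus has codim ≥ 6 > 4 = det's, and the Bernstein count of the support is (n−1)^{n²}2^{−O(n)}: generic-like counts are the default.
sources: BoraleviEtAl2025, BurgisserClausenShokrollahi1997, Vonzurgathen1987, Dolgachev2000
[crux] Dichotomy partner (negative side, staffed deliberately): a uniform 2^{O(n²)} bound — there is
C with #S ≤ 2^{C·n²+C} for every n and every finite affine section S of Γ(∇per_n). If proved the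
route is dead (kill criterion) AND a new structural fact about permanental minors is on record (a
'Cramer rule for per at the level of degrees', feeding card anti-cramer-direct-sum negatively); at
most one of SubPermanentCount / SubPermanentDegenerate holds. [difficulty: L] -/
@[route_item "route-ValiantsHypothesis-PolarDegree"]
def SubPermanentDegenerate : Prop :=
  ∃ C : ℕ, ∀ (n : ℕ) (A B : Matrix (Fin n × Fin n) (Fin n × Fin n) ℂ) (v : Fin n × Fin n → ℂ), {x : Fin n × Fin n → ℂ | ∀ k, ∑ p, A k p * x p + ∑ p, B k p * MvPolynomial.eval x (MvPolynomial.pderiv p (Literature.Computability.AlgebraicComplexity.perPoly (Fin n) ℂ)) = v k}.Finite → {x : Fin n × Fin n → ℂ | ∀ k, ∑ p, A k p * x p + ∑ p, B k p * MvPolynomial.eval x (MvPolynomial.pderiv p (Literature.Computability.AlgebraicComplexity.perPoly (Fin n) ℂ)) = v k}.ncard ≤ 2 ^ (C * n ^ 2 + C)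

/-- item stmt-ValiantsHypothesis-6245 · crux · rank 5 · closed · moot by None · by planner
why it might fail: Same as SubPermanentCount (auxiliary O(n²)-gate functions change log₂ of the count by O(n²) only, BCS (8.34)(2)); fails iff deg Γ(∇per_n) = 2^{O(n²)} infinitely often.
sources: BurgisserClausenShokrollahi1997, BaurStrassen1983, BoraleviEtAl2025
[crux] The bet in its weakest sufficient form (assembly antecedent; BCS (8.46) template): as
SubPermanentCount, but the n² affine equations may also involve auxiliary polynomials g_1..g_m read
off a fan-in-two circuit Q with ≤ C·n² gates (e.g. per_n itself, row/column sums, leading-block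
permanents used to triangularise the count). Implied by SubPermanentCount (PureImpliesAux);
equivalent to it up to the constant c by the degree bound applied to Q, but provable by an explicit
triangular count without Heintz's attainment theorem. [deps: SubPermanentCount] [difficulty: XL] -/
@[route_item "route-ValiantsHypothesis-PolarDegree"]
def SubPermanentCountAux : Prop :=
  ∃ c : ℝ, 0 < c ∧ ∃ C n₀ : ℕ, ∀ n ≥ n₀, ∃ (m : ℕ) (Q : Literature.Computability.AlgebraicComplexity.ArithCircuit ℂ (Fin n × Fin n)) (w : Fin m → Literature.Computability.AlgebraicComplexity.ArithCircuit.Operand ℂ (Fin n × Fin n)) (A B : Matrix (Fin n × Fin n) (Fin n × Fin n) ℂ) (B' : Matrix (Fin n × Fin n) (Fin m) ℂ) (v : Fin n × Fin n → ℂ), Q.IsFanInTwo ∧ Q.size ≤ C * n ^ 2 ∧ {x : Fin n × Fin n → ℂ | ∀ k, ∑ p, A k p * x p + ∑ p, B k p * MvPolynomial.eval x (MvPolynomial.pderiv p (Literature.Computability.AlgebraicComplexity.perPoly (Fin n) ℂ)) + ∑ j, B' k j * MvPolynomial.eval x ((w j).eval (Literature.Computability.AlgebraicComplexity.ArithCircuit.gateValues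 Q.gates)) = v k}.Finite ∧ (c * n) ^ (c * (n : ℝ) ^ 2) ≤ (({x : Fin n × Fin n → ℂ | ∀ k, ∑ p, A k p * x p + ∑ p, B k p * MvPolynomial.eval x (MvPolynomial.pderiv p (Literature.Computability.AlgebraicComplexity.perPoly (Fin n) ℂ)) + ∑ j, B' k j * MvPolynomial.eval x ((w j).eval (Literature.Computability.AlgebraicComplexity.ArithCircuit.gateValues Q.gates)) = v k}.ncard : ℕ) : ℝ)

/-- item stmt-ValiantsHypothesis-6246 · support · rank 9 · closed · moot by None · by planner
sources: BurgisserClausenShokrollahi1997, Heintz1983, Strassen1973DegreeBound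
[support] Strassen's degree bound in counting form, from the tree: for a fan-in-two circuit P over
variables σ and any operands u : τ → Operand read off its gate values, every FINITE set {x : A·x +
B·(u(x)) = v} (|σ| affine equations) has at most 2^{P.size + |σ|} points. Proof: (x, z) ↦ gate
equations z_g = (sum gate: linear | product gate: quadratic) plus the |σ| linear equations is a
system of degree ≤ 2 in |σ|+P.size unknowns whose zero set is in bijection with the section (z is
determined by x; junk references read 0 consistently), then
`Literature.RingTheory.ZeroDimensional.ncard_zeroSet_le_pow` with D = 2 (PROVED; BCS Rem (8.37)).
[difficulty: provable-now] -/
@[route_item "route-ValiantsHypothesis-PolarDegree"]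
def CircuitSectionCount : Prop :=
  ∀ (σ τ : Type) [Fintype σ] [DecidableEq σ] [Fintype τ] (P : Literature.Computability.AlgebraicComplexity.ArithCircuit ℂ σ), P.IsFanInTwo → ∀ (u : τ → Literature.Computability.AlgebraicComplexity.ArithCircuit.Operand ℂ σ) (A : Matrix σ σ ℂ) (B : Matrix σ τ ℂ) (v : σ → ℂ), {x : σ → ℂ | ∀ k : σ, ∑ p : σ, A k p * x p + ∑ q : τ, B k q * MvPolynomial.eval x ((u q).eval (Literature.Computability.AlgebraicComplexity.ArithCircuit.gateValues P.gates)) = v k}.Finite → {x : σ → ℂ | ∀ k : σ, ∑ p : σ, A k p * x p + ∑ q : τ, B k q * MvPolynomial.eval x ((u q).eval (Literature.Computability.AlgebraicComplexity.ArithCircuit.gateValues P.gates)) = v k}.ncard ≤ 2 ^ (P.size + Fintype.card σ)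

/-- item stmt-ValiantsHypothesis-6247 · support · rank 9 · closed · moot by None · by planner
sources: BurgisserClausenShokrollahi1997
[support] Glue: the pure count implies the auxiliary form (take m = 0, Q the empty circuit ⟨[],
const 0⟩, C = 0). [difficulty: provable-now] -/
@[route_item "route-ValiantsHypothesis-PolarDegree"]
def PureImpliesAux : Prop :=
  SubPermanentCount → SubPermanentCountAux

/-- item stmt-ValiantsHypothesis-6248 · support · rank 9 · closed · moot by None · by planner
sources: BurgisserClausenShokrollahi1997, Heintz1983, Dolgachev2000
[support] The determinant foil (calibration; repairs the audit's 'd_N = n−1 is not enough'): EVERY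
finite affine section of the graph of ∇det_n (the cofactor map) has at most (n+1)·4^{n²} points —
any 2^{O(n²)} bound is the point, the proof gives n·2^{n²}: W = {XY = λI} ⊂ ℂ^{2n²+1} is n² quadrics
(deg ≤ 2^{n²}, Heintz/BCS (8.28)); its main component W₀ = closure{(X, λX⁻¹, λ)} is irreducible of
dim n²+1; Γ' = {(X, adj X, det X)} is a component of W₀ ∩ {λ = det X} (deg ≤ n·2^{n²}); project λ
away (BCS (8.32)) and cut by the affine section (BCS (8.28)). Equivalently the projective degrees of
matrix inversion are ≤ binomial(n²−1, a) (refined Bezout on the Segre variety, XY ∈ ℂ·I being n²−1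
hyperplane sections). So Strassen–Baur–Strassen yields ≤ O(n²) for det: Cramer's rule (BCS Cor
(7.9)) is exactly the degeneracy. [difficulty: M] -/
@[route_item "route-ValiantsHypothesis-PolarDegree"]
def AdjugateSectionBound : Prop :=
  ∀ (n : ℕ) (A B : Matrix (Fin n × Fin n) (Fin n × Fin n) ℂ) (v : Fin n × Fin n → ℂ), {x : Fin n × Fin n → ℂ | ∀ k, ∑ p, A k p * x p + ∑ p, B k p * MvPolynomial.eval x (MvPolynomial.pderiv p (Literature.Computability.AlgebraicComplexity.detPoly (Fin n) ℂ)) = v k}.Finite → {x : Fin n × Fin n → ℂ | ∀ k, ∑ p, A k p * x p + ∑ p, B k p * MvPolynomial.eval x (MvPolynomial.pderiv p (Literature.Computability.AlgebraicComplexity.detPoly (Fin n) ℂ)) = v k}.ncard ≤ (n + 1) * 4 ^ (n ^ 2)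

/-- item stmt-ValiantsHypothesis-6249 · support · rank 9 · closed · moot by None · by planner
sources: Valiant1979, Burgisser2000, BurgisserClausenShokrollahi1997
[support] Honest-scope bookkeeping: the summit forces the waypoint region — VP_ℂ ≠ VNP_ℂ implies
L(per_n) is not O(n²) (per is VNP-complete:
`Literature.Computability.AlgebraicComplexity.isVNPComplete_perPoly_holds`,
`VP_ne_VNP_iff_not_isPComputable_of_isVNPComplete`, `isPFamily_perPoly`); the target
PermanentSuperlinear implies the same trivially. Neither converse is claimed. [difficulty:
provable-now] -/
@[route_item "route-ValiantsHypothesis-PolarDegree"]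
def SummitForcesWaypoint : Prop :=
  ValiantsHypothesis → ¬ ∃ C : ℕ, ∀ n : ℕ, Literature.Computability.AlgebraicComplexity.complexity (Literature.Computability.AlgebraicComplexity.perPoly (Fin n) ℂ) ≤ C * (n ^ 2 + 1)

-- item stmt-ValiantsHypothesis-8351 · support · rank 9 · closed · moot by None · by planner — informal only, no Lean statement yet:
--   [support — EXPERIMENT, cheapest falsifier, do first; kit] Small-n section counts of the
--   sub-permanent map versus the cofactor map. For n = 3: with random rational (A, B, v) count the
--   solutions in ℂ^9 of the 9 equations Σ_p A_kp x_p + Σ_p B_kp ∂_p f(x) = v_k (degree ≤ 2; Bezout 512)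
--   for f = per_3 and for f = det_3 (msolve / Gröbner basis over 𝔽_p and ℚ, or certified homotopy
--   continuation; generic (A,B,v) attain the maximum = deg Γ(∇f), BCS (8.30)); report both numbers, the
--   pure polar fibre counts (A = 0, B = I; det_3 control = 2) and 9!·vol(Q_3) (Normaliz/polymake) where
--   Q_n = conv(0, e_ij, {M

/-- item stmt-ValiantsHypothesis-6250 · assembly · rank 1 · closed · moot by None · by planner
sources: BurgisserClausenShokrollahi1997, BaurStrassen1983
[assembly] BaurStrassenGradient → CircuitSectionCount → SubPermanentCountAux → PermanentSuperlinear
(waypoint target; honest scope). -/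
@[route_item "route-ValiantsHypothesis-PolarDegree"]
def Assembly : Prop :=
  BaurStrassenGradient → CircuitSectionCount → SubPermanentCountAux → PermanentSuperlinear

end Summit.ValiantsHypothesis.ValiantsHypothesis.Theses.PolarDegree
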